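import Literature.AlgebraicGeometry.AbelianSchemes.LevelSectionsSubgroup
import Literature.AlgebraicGeometry.AbelianSchemes.FibrePointsMulEquivPoints
import Literature.AlgebraicGeometry.AbelianSchemes.TorsionPointsLocallyConstant
import HarnessLib

/-!
# The basis of a level structure as a group isomorphism `(ℤ/n)^{2g} ⥲ A_s[n](Ω)` at a geometric point, and
# `n`-torsion sections over a connected base ([MumfordFogartyKirwan1994] Ch. 7 §2 Def. 7.1; [GortzWedhorn2023] 27.188)

Cell `hodgecm-mathlib`, F-DAG (h9-S) (W3c) assembly inputs (B-p13 (g19) under B-p11 (g16)'s W3 lead), generic in a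
level-`n` structure `φ` on an abelian scheme `A/S` (★ `AbelianSchemeOverBase`):

* §1 — at a geometric point `s : Spec Ω → S` the basis clauses of `φ` ([MFK94] Def. 7.1 (i) «the images `σᵢ(s)` form a
  basis for the group of points of order `n` on `X̄_s`»), which the carrier states in the `FibrePoints` currency
  (`A.restrict s`), read in the `Ω`-POINTS currency of the fibre abelian variety (`A.restrictPt s`, the currency of ★
  `Motives.AbelianVariety.torsionPoints` / `weilPairingLevel` / ★ `SymplecticLift`): `restrictPt_section_injective`,
  `exists_restrictPt_section_eq` (every `n`-torsion `Ω`-point is some `σ^a(s)`; ★ `exists_mulEquiv_fibrePoints_points`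
  + ★ `eq_restrictPt_iff_eq_restrict`), `exists_monoidHom_section` (`a ↦ σ^a` as a homomorphism
  `Multiplicative (ℤ/n)^{2g} →* A(S)` on a commutative `A`, ★ `section_add`), and the package
  **`exists_monoidHom_torsionPoints_bijective`**: `∃ L : (ℤ/n)^{2g} →* A_s[n](Ω)` BIJECTIVE with
  `L a = σ^a(s)` and `L eᵢ = σᵢ(s)` — the `Ψᵢ` / `Function.Bijective` inputs of ★ `SimilitudeTransport` and of ★
  `nonempty_symplecticLift_iff_forall_level`;
* §2 — over a CONNECTED base with `n` invertible an `n`-torsion section `b ∈ A(S)` IS one of the basis combinations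
  GLOBALLY: `exists_eq_section_of_pow_eq_one` (`∃ a, b = σ^a`; ★ `exists_isClopen_comp_eq_section` gives a clopen
  neighbourhood of any point on which `b = σ^a`, and a non-empty clopen of a preconnected space is everything) — the
  «constant coordinates of the marks» step of (W3c).

Theorems only; no definition, no named fact, no instance, no `sorry`.  HC_CM is proved only modulo the 7 printed
citations until rung 0 closes; count-neutral capital for F-6 (V′).

## References
* [MumfordFogartyKirwan1994] D. Mumford, J. Fogarty, F. Kirwan, *Geometric Invariant Theory*, 3rd ed. (1994), Ch. 7 §2
  Definition 7.1 (p. 129).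
* [GortzWedhorn2023] U. Görtz, T. Wedhorn, *Algebraic Geometry II* (2023), Prop. 27.188 (1) (p. 675).
* [GortzWedhorn2020] U. Görtz, T. Wedhorn, *Algebraic Geometry I*, 2nd ed. (2020), Section (4.7), (4.7.1) (p. 108).
-/

noncomputable section

universe u

open CategoryTheory CategoryTheory.Limits AlgebraicGeometry

namespace Literature.AlgebraicGeometry.AbelianSchemes

namespace AbelianSchemeOver

open Literature.AlgebraicGeometry.Motives
open scoped MonObj

namespace LevelStructure

variable {S : Scheme.{u}} {A : AbelianSchemeOver S} {g n : ℕ} (φ : LevelStructure g n A)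

/-! ### §1 The basis at a geometric point, in the `Ω`-points currency -/

section Points

variable {Ω : Type u} [Field Ω] (s : Spec (.of Ω) ⟶ S)

/-- `σ^a(s)` is `n`-torsion: `σ^a(s)^n = 1` in `A_s(Ω)` (on a commutative `A`). [cite: MumfordFogartyKirwan1994, Ch. 7 §2 Definition 7.1 (p. 129)] -/
theorem restrictPt_section_pow_eq_one [IsCommMonObj A.X] (a : Fin g ⊕ Fin g → ZMod n) :
    A.restrictPt s (φ.section_ a) ^ n = 1 :=
  A.restrictPt_pow_eq_one s (A.sectionPow_pow_eq_one φ.pow_σ a)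

/-- `σᵢ(s)^n = 1` in `A_s(Ω)`. [cite: MumfordFogartyKirwan1994, Ch. 7 §2 Definition 7.1 (p. 129)] -/
theorem restrictPt_σ_pow_eq_one (i : Fin g ⊕ Fin g) : A.restrictPt s (φ.σ i) ^ n = 1 :=
  A.restrictPt_pow_eq_one s (φ.pow_σ i)

/-- **Def. 7.1 (i), injectivity, in `Ω`-points**: `a ↦ σ^a(s)` is injective on `(ℤ/n)^{2g}` at every geometric point
(★ `basis_injective` through ★ `restrictPt_eq_restrictPt_iff`). [cite: MumfordFogartyKirwan1994, Ch. 7 §2 Definition 7.1 (p. 129)] -/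
theorem restrictPt_section_injective [IsAlgClosed Ω] :
    Function.Injective fun a : Fin g ⊕ Fin g → ZMod n => A.restrictPt s (φ.section_ a) := fun _ _ hab =>
  φ.basis_injective s ((A.restrictPt_eq_restrictPt_iff s _ _).1 hab)

/-- **Def. 7.1 (i), surjectivity, in `Ω`-points**: every `Ω`-point `P` of the fibre with `P^n = 1` is `σ^a(s)` for some
`a ∈ (ℤ/n)^{2g}` (★ `basis_surjective` in the `FibrePoints` currency, moved across the group isomorphism
`Hom_S(Spec Ω, A) ≃* A_s(Ω)` of ★ `exists_mulEquiv_fibrePoints_points`). [cite: MumfordFogartyKirwan1994, Ch. 7 §2 Definition 7.1 (p. 129)]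
[cite: GortzWedhorn2020, Section (4.7), (4.7.1) (p. 108)] -/
theorem exists_restrictPt_section_eq [IsAlgClosed Ω] (P : (A.fibre s).toAbelianVariety.Points Ω) (hP : P ^ n = 1) :
    ∃ a : Fin g ⊕ Fin g → ZMod n, A.restrictPt s (φ.section_ a) = P := by
  obtain ⟨e, he⟩ := A.exists_mulEquiv_fibrePoints_points s
  have hx : e.symm P ^ n = 1 := by rw [← map_pow, hP, map_one]
  obtain ⟨a, ha⟩ := φ.basis_surjective s (e.symm P) hx
  refine ⟨a, ?_⟩
  have hpartner : A.fibrePointToLeft s P = (e.symm P).left := by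
    have h := he (e.symm P)
    rwa [e.apply_symm_apply] at h
  exact ((A.eq_restrictPt_iff_eq_restrict s hpartner (φ.section_ a)).2 ha.symm).symm

/-- **`a ↦ σ^a` is a group homomorphism `(ℤ/n)^{2g} → A(S)`** on a commutative `A` (existence form; ★ `section_add`,
★ `section_zero`). [cite: MumfordFogartyKirwan1994, Ch. 7 §2 Definition 7.1 (p. 129)] -/
theorem exists_monoidHom_section [IsCommMonObj A.X] [NeZero n] :
    ∃ Sg : Multiplicative (Fin g ⊕ Fin g → ZMod n) →* A.Sections,
      ∀ a : Fin g ⊕ Fin g → ZMod n, Sg (Multiplicative.ofAdd a) = φ.section_ a :=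
  ⟨{ toFun := fun c => φ.section_ c.toAdd
     map_one' := φ.section_zero
     map_mul' := fun c d => φ.section_add c.toAdd d.toAdd }, fun _ => rfl⟩

/-- **THE BASIS OF `φ` AT A GEOMETRIC POINT AS A GROUP ISOMORPHISM `(ℤ/n)^{2g} ⥲ A_s[n](Ω)`** ([MFK94] Def. 7.1 (i) in
the `Ω`-points currency): on a commutative `A` (`n ≠ 0`) there is a BIJECTIVE homomorphism
`L : Multiplicative (ℤ/n)^{2g} →* A_s[n](Ω)` with `L a = σ^a(s)` for all `a`, in particular `L eᵢ = σᵢ(s)`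
(★ `sectionPow_single`). [cite: MumfordFogartyKirwan1994, Ch. 7 §2 Definition 7.1 (p. 129)]
[cite: GortzWedhorn2020, Section (4.7), (4.7.1) (p. 108)] -/
theorem exists_monoidHom_torsionPoints_bijective [IsCommMonObj A.X] [NeZero n] [IsAlgClosed Ω] :
    ∃ L : Multiplicative (Fin g ⊕ Fin g → ZMod n) →* (A.fibre s).toAbelianVariety.torsionPoints Ω (n : ℤ),
      Function.Bijective L ∧
      (∀ a : Fin g ⊕ Fin g → ZMod n,
        ((L (Multiplicative.ofAdd a) : (A.fibre s).toAbelianVariety.torsionPoints Ω (n : ℤ)) :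
          (A.fibre s).toAbelianVariety.Points Ω) = A.restrictPt s (φ.section_ a)) ∧
      ∀ i : Fin g ⊕ Fin g,
        ((L (Multiplicative.ofAdd (Pi.single i 1)) : (A.fibre s).toAbelianVariety.torsionPoints Ω (n : ℤ)) :
          (A.fibre s).toAbelianVariety.Points Ω) = A.restrictPt s (φ.σ i) := by
  obtain ⟨Sg, hSg⟩ := φ.exists_monoidHom_section
  -- `a ↦ σ^a(s)` as a homomorphism into `A_s(Ω)`, landing in the `n`-torsion
  let L₀ : Multiplicative (Fin g ⊕ Fin g → ZMod n) →* (A.fibre s).toAbelianVariety.Points Ω :=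
    (MonoidHom.mk' (fun σ : A.Sections => A.restrictPt s σ) (A.restrictPt_mul s)).comp Sg
  have hL₀ : ∀ a, L₀ (Multiplicative.ofAdd a) = A.restrictPt s (φ.section_ a) := fun a => by
    change A.restrictPt s (Sg (Multiplicative.ofAdd a)) = _
    rw [hSg a]
  have hmem : ∀ c, L₀ c ∈ (A.fibre s).toAbelianVariety.torsionPoints Ω (n : ℤ) := fun c => by
    rw [AbelianVariety.mem_torsionPoints_iff, zpow_natCast, ← ofAdd_toAdd c, hL₀]
    exact φ.restrictPt_section_pow_eq_one s c.toAdd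
  refine ⟨L₀.codRestrict _ hmem, ⟨fun c d hcd => ?_, fun P => ?_⟩, fun a => hL₀ a, fun i => ?_⟩
  · -- injective
    have h : L₀ c = L₀ d := congrArg Subtype.val hcd
    rw [← ofAdd_toAdd c, ← ofAdd_toAdd d, hL₀, hL₀] at h
    rw [← ofAdd_toAdd c, ← ofAdd_toAdd d, φ.restrictPt_section_injective s h]
  · -- surjective onto the `n`-torsion
    have hP : (P : (A.fibre s).toAbelianVariety.Points Ω) ^ n = 1 := by
      rw [← zpow_natCast]
      exact (AbelianVariety.mem_torsionPoints_iff _ _).1 P.2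
    obtain ⟨a, ha⟩ := φ.exists_restrictPt_section_eq s P hP
    exact ⟨Multiplicative.ofAdd a, Subtype.ext ((hL₀ a).trans ha)⟩
  · -- the basis vectors
    change L₀ (Multiplicative.ofAdd (Pi.single i 1)) = _
    rw [hL₀, LevelStructure.section_, LevelStructure.sectionPow_single φ.pow_σ i]

end Points

/-! ### §2 `n`-torsion sections over a connected base are basis combinations -/

/-- **Over a CONNECTED base with `n` invertible, an `n`-torsion section is GLOBALLY a basis combination**: for `A`
commutative, `φ` a level-`n` structure, `b ∈ A(S)` with `b^n = 1` and `S` preconnected with a point `s₀`, there is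
`a ∈ (ℤ/n)^{2g}` with `b = σ^a` — ★ `exists_isClopen_comp_eq_section` (the equaliser of the two sections of the finite
étale `A[n] → S` is clopen) and a non-empty clopen subset of a preconnected space is the whole space.
[cite: GortzWedhorn2023, Prop. 27.188 (1) (p. 675)] [cite: MumfordFogartyKirwan1994, Ch. 7 §2 Definition 7.1 (p. 129)] -/
theorem exists_eq_section_of_pow_eq_one [IsCommMonObj A.X] [PreconnectedSpace S]
    (hn : ∀ s : S, (n : S.residueField s) ≠ 0) {b : A.Sections} (hb : b ^ n = 1) (s₀ : S) :
    ∃ a : Fin g ⊕ Fin g → ZMod n, b = φ.section_ a := by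
  obtain ⟨a, U, hU, hs₀, hcomp⟩ := φ.exists_isClopen_comp_eq_section A hn hb s₀
  refine ⟨a, ?_⟩
  -- the clopen `U ∋ s₀` is everything
  have hUtop : U = ⊤ := by
    exact TopologicalSpace.Opens.ext (hU.eq_univ ⟨s₀, hs₀⟩)
  subst hUtop
  -- `⊤.ι` is an epimorphism (an isomorphism)
  haveI : IsIso (⊤ : S.Opens).ι := (Scheme.topIso S).isIso_hom
  apply Over.OverMorphism.ext
  exact (cancel_epi (⊤ : S.Opens).ι).1 hcomp

/-- Pointwise form: under the same hypotheses `b(s) = σ^a(s)` at EVERY field-valued point `s` of `S`, for ONE `a`.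
[cite: GortzWedhorn2023, Prop. 27.188 (1) (p. 675)] [cite: MumfordFogartyKirwan1994, Ch. 7 §2 Definition 7.1 (p. 129)] -/
theorem exists_forall_restrictPt_eq_restrictPt_section [IsCommMonObj A.X] [PreconnectedSpace S]
    (hn : ∀ s : S, (n : S.residueField s) ≠ 0) {b : A.Sections} (hb : b ^ n = 1) (s₀ : S) :
    ∃ a : Fin g ⊕ Fin g → ZMod n, ∀ ⦃Ω : Type u⦄ [Field Ω] (s : Spec (.of Ω) ⟶ S),
      A.restrictPt s b = A.restrictPt s (φ.section_ a) := by
  obtain ⟨a, rfl⟩ := φ.exists_eq_section_of_pow_eq_one hn hb s₀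
  exact ⟨a, fun Ω _ s => rfl⟩

end LevelStructure

end AbelianSchemeOver

end Literature.AlgebraicGeometry.AbelianSchemes

end
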